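import Literature.NumberTheory.Transcendental.CijsouwWaldschmidt1977Steps
import Literature.NumberTheory.Transcendental.Waldschmidt1980Liouville
import HarnessLib

/-!
# Waldschmidt 1980, Lemmas 3.4–3.7 over `ℚ` (`q = 2`): the extrapolation in `k` and the half step

Support file (plain definitions and theorems; no named facts) for the archimedean input of the
Stewart–Yu 1991 line of `Literature.Barriers.ABC.stewartYu1991_upperBound` (M. Waldschmidt,
*A lower bound for linear forms in logarithms*, Acta Arith. **37** (1980), Prop. 3.8 over `ℚ`,
`q = 2`), written ON THE OBJECTS of the tree's Cijsouw–Waldschmidt 1977 files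
(`CijsouwWaldschmidt1977{Setup,Steps}.lean`: `CW77.Setup`, the boxes of level `J`, the functions
`F = f_{J,τ}`, `Φ = φ_{J,τ}` and their rational cores `coreSum`, the half-point class sums
`classVec` with denominators `Dhalf`, the `2`-descent `descent_algebra`).

Waldschmidt's §3 differs from Cijsouw–Waldschmidt's §4 in ONE structural point (p. 259: "The
method of [4], which avoids the extrapolation procedure, would give essentially the same bound as
our theorem, apart from the term `nⁿ` which would be replaced by `q^{n²}`"): inside each level `J`
of the descent, before passing to the points `s/q`, the set of integer zeros is doubled `n` times
(Lemma 3.6: from `0 ≤ s ≤ q^{J+k}S`, `|τ| ≤ (1 − k/2n)q^{−J}T` to `k + 1`, each step an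
interpolation (Lemma 3.5 = Lemma 2.3) plus a Liouville estimate at INTEGER points (Lemma 3.4,
(3.21))), so that the final interpolation at the points `s/q` (Lemma 3.7) has `qⁿ` times more
zeros to work with, which pays for the degree `qⁿ` in the Liouville estimate (3.22) at `s/q`.
This file provides exactly these steps, with all sizes as explicit hypotheses (constants are fixed
only in the assembly file):

* `DclearJ`, `exists_int_DclearJ_mul_qTerm`, `coreSum_eq_zero_of_abs_lt` — denominators of
  `φ_{J,τ}(s)` at the integer points of level `J` and the trivial Liouville estimate (3.21) over `ℚ`;
* `w80_norm_Φ_le_of_odd_zeros` — **Lemma 3.5**: if `φ_{J,τ''}(s') = 0` for all odd `s' < SK` and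
  `|τ''| < Tlo`, then for `|τ| + t ≤ Tlo` and any `z₀` with `|(z₀−1)/2| ≤ 2⌊SK/2⌋`, `|z₀| ≤ 7 SK`,
  `|φ_{J,τ}(z₀)| ≤ δ` (Hermite interpolation of `g(w) = f_{J,τ}(2w+1)` at the `SK/2` integer nodes
  with `t` derivatives — the tree's `CW77.hermite_integer_points` — and Lemma 9 `norm_F_sub_Φ_le`);
* `w80_kstep` — **Lemma 3.6, one step**: the zeros extend to all odd `s < 2·SK` (for
  `|τ| + t ≤ Tlo`) as soon as `δ < 1/Dmax`;
* `w80_halfstep` — **Lemma 3.7 and (3.22)**: `φ_{J,τ}(s/2) = 0` for odd `s < 2^{J+1}S₀`,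
  `|τ| + t ≤ Tlo`, as soon as `δ < M/(4 Dmax M (∏ H(αᵢ))²)^{2^{d+1}}` (the SHARP Liouville
  inequality `Waldschmidt1980.abs_ev_ge_sharp` on the class sums), ready for `CW77.Setup.descent_algebra`.

## References

* [Waldschmidt1980] M. Waldschmidt, *A lower bound for linear forms in logarithms*, Acta Arith. 37
  (1980), 257–283 — Lemmas 3.4–3.7 (pp. 269–272).
* [CijsouwWaldschmidt1977] P. L. Cijsouw, M. Waldschmidt, Compositio Math. 34 (1977) — §4
  (the tree's files, whose Step 2 `half_vanish` is the model of the proofs below).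
-/

noncomputable section

open Complex Finset Polynomial
open Literature.NumberTheory.Transcendental.Baker1975
open Literature.NumberTheory.Transcendental.Baker1975.Ch3

namespace Literature.NumberTheory.Transcendental.CW77

namespace Setup

variable (S : Setup) {h Lb : ℕ}

/-! ### Denominators at the integer points of level `J` and the Liouville estimate (3.21) -/

/-- The clearing denominator of `coreSum_{J,τ}(s)` on the box of level `J`:
`D_J(s,τ) = ν(2^{J₀−J}s, h)^{τ₀} · |b_θ|^{|τ'|} · ∏ den(αⱼ)^{⌊Lⱼ/2^J⌋ s} · den(θ)^{⌊L_θ/2^J⌋ s}`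
(Waldschmidt's `d_{J+1,τ,s}` of (3.23) together with the denominators of the `βᵣ` and `αⱼ`;
the tree's `CW77.Setup.Dclear` is the case `J = 0`). [cite: Waldschmidt1980, Lemma 3.4 (p. 269)] -/
def DclearJ (J₀ J : ℕ) (L : Fin S.d → ℕ) (Lθ : ℕ) (s : ℕ) (τ : Tau S.d) : ℕ :=
  nuBound (scale J₀ J * s) h ^ τ.1 * S.bθ.natAbs ^ (∑ j, τ.2 j) *
    ((∏ j, (S.α j).den ^ (L j / 2 ^ J * s)) * S.θ.den ^ (Lθ / 2 ^ J * s))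

/-- `D_J(s,τ) > 0`. [folklore] -/
theorem DclearJ_pos (J₀ J : ℕ) (L : Fin S.d → ℕ) (Lθ : ℕ) (s : ℕ) (τ : Tau S.d) :
    0 < S.DclearJ (h := h) J₀ J L Lθ s τ := by
  unfold DclearJ
  refine Nat.mul_pos (Nat.mul_pos (Nat.pow_pos (nuBound_pos _ _)) (Nat.pow_pos ?_))
    (Nat.mul_pos ?_ (Nat.pow_pos S.θ.pos))
  · exact Int.natAbs_pos.mpr S.bθ_ne
  · exact prod_pos fun j _ => Nat.pow_pos (S.α j).pos

/-- **`D_J(s,τ) · qTerm_{J}(u,τ,s) ∈ ℤ` on the box of level `J`.** [cite: Waldschmidt1980, Lemma 3.4 (p. 269)] -/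
theorem exists_int_DclearJ_mul_qTerm (J₀ J : ℕ) {L : Fin S.d → ℕ} {Lθ : ℕ} {u : Idx S.d h Lb}
    (hu : u ∈ S.box (h := h) (Lb := Lb) L Lθ J) (τ : Tau S.d) (s : ℕ) :
    ∃ z : ℤ, ((S.DclearJ (h := h) J₀ J L Lθ s τ : ℕ) : ℚ) * S.qTerm J₀ J u τ s = z := by
  rw [S.mem_box] at hu
  obtain ⟨z₁, hz₁⟩ := S.exists_int_qΔ J₀ J u τ.1 s
  obtain ⟨z₂, hz₂⟩ := S.exists_int_qA u τ.2
  obtain ⟨z₃, hz₃⟩ := S.exists_int_qE (L := fun j => L j / 2 ^ J) (Lθ := Lθ / 2 ^ J) hu s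
  refine ⟨z₁ * z₂ * z₃, ?_⟩
  unfold DclearJ qTerm
  push_cast at hz₁ hz₂ hz₃ ⊢
  rw [← hz₁, ← hz₂, ← hz₃]; ring

/-- **The Liouville estimate (3.21) over `ℚ`**: a rational number with denominator dividing
`D ≤ Dmax` and absolute value `< 1/Dmax` vanishes; applied to `coreSum_{J,τ}(s)`.
[cite: Waldschmidt1980, Lemma 3.4 (3.21) (p. 269)] -/
theorem coreSum_eq_zero_of_abs_lt (J₀ J : ℕ) (L : Fin S.d → ℕ) (Lθ : ℕ) (p : Idx S.d h Lb → ℤ)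
    (τ : Tau S.d) (s : ℕ) {Dmax : ℝ}
    (hD : ((S.DclearJ (h := h) J₀ J L Lθ s τ : ℕ) : ℝ) ≤ Dmax)
    (hlt : |(S.coreSum J₀ J (S.box (h := h) (Lb := Lb) L Lθ J) p τ s : ℝ)| < 1 / Dmax) :
    S.coreSum J₀ J (S.box (h := h) (Lb := Lb) L Lθ J) p τ s = 0 := by
  classical
  set boxJ := S.box (h := h) (Lb := Lb) L Lθ J with hbox
  set D : ℕ := S.DclearJ (h := h) J₀ J L Lθ s τ with hDdef
  have hD1 : 1 ≤ D := S.DclearJ_pos J₀ J L Lθ s τ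
  -- `D · coreSum ∈ ℤ`
  have hint : ∃ z : ℤ, ((D : ℕ) : ℚ) * S.coreSum J₀ J boxJ p τ s = z := by
    unfold coreSum
    rw [mul_sum]
    have hterm : ∀ u ∈ boxJ, ∃ z : ℤ, ((D : ℕ) : ℚ) * ((p u : ℚ) * S.qTerm J₀ J u τ s) = z := by
      intro u hu
      obtain ⟨z, hz⟩ := S.exists_int_DclearJ_mul_qTerm J₀ J hu τ s
      exact ⟨p u * z, by push_cast; rw [← hz]; ring⟩
    choose z hz using hterm
    refine ⟨∑ u ∈ boxJ.attach, z u.1 u.2, ?_⟩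
    push_cast
    rw [← sum_attach]
    exact sum_congr rfl fun u _ => hz u.1 u.2
  obtain ⟨z, hz⟩ := hint
  by_contra hne
  have hz0 : z ≠ 0 := by
    rintro rfl
    rw [Int.cast_zero, mul_eq_zero] at hz
    rcases hz with h0 | h0
    · exact absurd (by exact_mod_cast h0 : D = 0) (by omega)
    · exact hne h0
  have hz1 : (1 : ℝ) ≤ |(z : ℝ)| := by exact_mod_cast Int.one_le_abs hz0
  have hD0 : (0 : ℝ) < D := by exact_mod_cast hD1
  have hDmax0 : 0 < Dmax := lt_of_lt_of_le hD0 hD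
  have hc : (S.coreSum J₀ J boxJ p τ s : ℝ) = z / D := by
    have h' : (D : ℝ) * (S.coreSum J₀ J boxJ p τ s : ℝ) = z := by exact_mod_cast hz
    field_simp; linarith
  have hge : 1 / Dmax ≤ |(S.coreSum J₀ J boxJ p τ s : ℝ)| := by
    rw [hc, abs_div, abs_of_pos hD0]
    calc 1 / Dmax ≤ 1 / (D : ℝ) := one_div_le_one_div_of_le hD0 hD
      _ ≤ |(z : ℝ)| / D := by rw [le_div_iff₀ hD0]; field_simp; exact hz1
  linarith

/-! ### Lemma 3.5: the interpolation from the odd zeros below `SK` -/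

set_option maxHeartbeats 800000 in
/-- **Waldschmidt 1980, Lemma 3.5 (the interpolation step), on the objects of the tree's
Cijsouw–Waldschmidt files.** Let `p` be supported in the box of level `J` with `|p(u)| ≤ Pr`, and
suppose `φ_{J,τ''}(s') = 0` for all odd `s' < SK` (`SK ≥ 2`) and all `|τ''| < Tlo`. Let `τ` be a
multi-order with `|τ| + t ≤ Tlo` (`t ≥ 1`). With uniform bounds `Q ≥ |Qw m (w_u) 0 z|`
(`m ≤ Tlo`, `|z| ≤ 7 SK`), `G_A ≥ |A(u,τ')|` (`|τ'| ≤ Tlo`), `Ψ ≥ |ψ_u|, |ψ_u + λ_θΛ₀|`, the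
smallness `⌊L_θ/2^J⌋ |Λ₀| · 7 SK ≤ x ≤ 1` and `Cl ≥ 1 + ∑|log αⱼ|`, every point `z₀` with
`|(z₀ − 1)/2| ≤ 2⌊SK/2⌋` and `|z₀| ≤ 7 SK` satisfies `|φ_{J,τ}(z₀)| ≤ δ`,
`δ = 2 k^{t+1} t (28e)^{kt} (2Cl)^t ε₉ + B_f (3/5)^{kt} + ε₉` (`k = SK/2` nodes,
`ε₉ = N Pr Q G_A e^{7ΨSK} · 2x`, `B_f = N Pr Q G_A e^{7ΨSK}`): Hermite interpolation of
`g(w) = f_{J,τ}(2w+1)` at the integer nodes `w = i < SK/2` with `t` derivatives, plus Lemma 9.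
[cite: Waldschmidt1980, Lemma 3.5 (pp. 270–272)] -/
theorem w80_norm_Φ_le_of_odd_zeros
    {J₀ J : ℕ} {L : Fin S.d → ℕ} {Lθ : ℕ} {p : Idx S.d h Lb → ℤ}
    {SK Tlo t : ℕ} (hSK : 2 ≤ SK) (ht1 : 1 ≤ t)
    (hzero : ∀ s', s' < SK → Odd s' → ∀ τ'' : Tau S.d, tauNorm τ'' < Tlo →
      S.coreSum J₀ J (S.box (h := h) (Lb := Lb) L Lθ J) p τ'' s' = 0)
    (τ : Tau S.d) (hτ : tauNorm τ + t ≤ Tlo)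
    {Nr : ℝ} (hNr : ((S.box (h := h) (Lb := Lb) L Lθ J).card : ℝ) ≤ Nr) (hNr1 : 1 ≤ Nr)
    {Q GA Ψ x Cl Pr : ℝ} (hp_abs : ∀ u ∈ S.box (h := h) (Lb := Lb) L Lθ J, |(p u : ℝ)| ≤ Pr) (hPr : 1 ≤ Pr)
    (hQ : ∀ u ∈ S.box (h := h) (Lb := Lb) L Lθ J, ∀ m, m ≤ Tlo → ∀ z : ℂ, ‖z‖ ≤ 7 * (SK : ℝ) →
      ‖Qw m (S.wOf J₀ J u) 0 z‖ ≤ Q) (hQ1 : 1 ≤ Q)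
    (hA : ∀ u ∈ S.box (h := h) (Lb := Lb) L Lθ J, ∀ τ' : Fin S.d → ℕ, ∑ j, τ' j ≤ Tlo → ‖S.A u τ'‖ ≤ GA)
    (hGA1 : 1 ≤ GA)
    (hψ : ∀ u ∈ S.box (h := h) (Lb := Lb) L Lθ J, |S.ψ u| ≤ Ψ ∧ |S.expo u| ≤ Ψ) (hΨ0 : 0 ≤ Ψ)
    (hx : ((Lθ / 2 ^ J : ℕ) : ℝ) * |S.Λ₀| * (7 * (SK : ℝ)) ≤ x) (hx1 : x ≤ 1) (hx0 : 0 ≤ x)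
    (hCl : 1 + ∑ j, |S.l j| ≤ Cl)
    (z₀ : ℂ) (hz₀ : ‖(z₀ - 1) / 2‖ ≤ 2 * ((SK / 2 : ℕ) : ℝ)) (hz₀' : ‖z₀‖ ≤ 7 * (SK : ℝ)) :
    let kpts : ℕ := SK / 2
    let ε₉ : ℝ := Nr * Pr * (Q * GA * Real.exp (Ψ * (7 * (SK : ℝ)))) * (2 * x)
    let Bf : ℝ := Nr * Pr * (Q * GA * Real.exp (Ψ * (7 * (SK : ℝ))))
    ‖S.Φ J₀ J (S.box (h := h) (Lb := Lb) L Lθ J) p τ z₀‖ ≤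
      2 * (kpts : ℝ) ^ (t + 1) * t * (28 * Real.exp 1) ^ (kpts * t) * ((2 * Cl) ^ t * ε₉) +
        Bf * (3 / 5) ^ (kpts * t) + ε₉ := by
  classical
  intro kpts ε₉ Bf
  set boxJ := S.box (h := h) (Lb := Lb) L Lθ J with hboxJ
  set N : ℝ := Nr with hN
  have hkpts1 : 1 ≤ kpts := by show 1 ≤ SK / 2; omega
  have hSK2 : 2 * kpts ≤ SK := by show 2 * (SK / 2) ≤ SK; omega
  have hSKk : SK ≤ 2 * kpts + 1 := by show SK ≤ 2 * (SK / 2) + 1; omega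
  -- basic facts on the box
  have hLθ : ∀ u ∈ boxJ, u.2.2 ≤ Lθ / 2 ^ J := fun u hu => (S.mem_box.mp hu).2
  have hN0' : (0 : ℝ) ≤ N := by rw [hN]; linarith
  have hcardN : ∀ {y : ℝ}, 0 ≤ y → (boxJ.card : ℝ) * Pr * y ≤ N * Pr * y := fun hy =>
    mul_le_mul_of_nonneg_right (mul_le_mul_of_nonneg_right (by rw [hN]; exact hNr) (by linarith)) hy
  -- (1) zeros of `φ` at odd `s' < SK`
  have hzeroΦ : ∀ s', s' < SK → Odd s' → ∀ τ'' : Tau S.d, tauNorm τ'' < Tlo →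
      S.Φ J₀ J boxJ p τ'' (s' : ℂ) = 0 :=
    fun s' hs' ho τ'' hτ'' => (S.Φ_natCast_eq_zero_iff J₀ J boxJ p τ'' s').mpr (hzero s' hs' ho τ'' hτ'')
  -- (2) Lemma 9 on `|z| ≤ 7 SK`
  have hL9 : ∀ τ'' : Tau S.d, tauNorm τ'' ≤ Tlo → ∀ z : ℂ, ‖z‖ ≤ 7 * (SK : ℝ) →
      ‖S.F J₀ J boxJ p τ'' z - S.Φ J₀ J boxJ p τ'' z‖ ≤ ε₉ := by
    intro τ'' hτ'' z hz
    have h1 := S.norm_F_sub_Φ_le J₀ J boxJ p τ'' z (P := Pr) (Q := Q) (GA := GA) (Ψ := Ψ) (x := x)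
      (Lθ := Lθ / 2 ^ J) hp_abs
      (fun u hu => hQ u hu τ''.1 (by unfold tauNorm at hτ''; omega) z hz)
      (fun u hu => hA u hu τ''.2 (by unfold tauNorm at hτ''; omega))
      (fun u hu => (hψ u hu).1) hLθ
      (le_trans (mul_le_mul_of_nonneg_left hz (by positivity)) hx) hx1
    have hmono : N * Pr * (Q * GA * Real.exp (Ψ * ‖z‖)) ≤ Bf := by
      show N * Pr * (Q * GA * Real.exp (Ψ * ‖z‖)) ≤ Nr * Pr * (Q * GA * Real.exp (Ψ * (7 * (SK : ℝ))))
      rw [← hN]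
      apply mul_le_mul_of_nonneg_left _ (mul_nonneg hN0' (by linarith))
      apply mul_le_mul_of_nonneg_left _ (mul_nonneg (by linarith) (by linarith))
      exact Real.exp_le_exp.mpr (mul_le_mul_of_nonneg_left hz hΨ0)
    calc ‖S.F J₀ J boxJ p τ'' z - S.Φ J₀ J boxJ p τ'' z‖
        ≤ (boxJ.card : ℝ) * Pr * (Q * GA * Real.exp (Ψ * ‖z‖)) * (2 * x) := h1
      _ ≤ N * Pr * (Q * GA * Real.exp (Ψ * ‖z‖)) * (2 * x) :=
          mul_le_mul_of_nonneg_right (hcardN (by positivity)) (by linarith)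
      _ ≤ Bf * (2 * x) := mul_le_mul_of_nonneg_right hmono (by linarith)
      _ = ε₉ := by show Bf * (2 * x) = Nr * Pr * (Q * GA * Real.exp (Ψ * (7 * (SK : ℝ)))) * (2 * x); rfl
  have hSK7 : ∀ s', s' < SK → ‖((s' : ℕ) : ℂ)‖ ≤ 7 * (SK : ℝ) := by
    intro s' hs'
    rw [Complex.norm_natCast]
    have : (s' : ℝ) ≤ SK := by exact_mod_cast hs'.le
    have : (0 : ℝ) ≤ SK := by positivity
    linarith
  -- (3) smallness of `f` at the odd points
  have hFsmall : ∀ s', s' < SK → Odd s' → ∀ τ'' : Tau S.d, tauNorm τ'' ≤ Tlo - 1 →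
      ‖S.F J₀ J boxJ p τ'' (s' : ℂ)‖ ≤ ε₉ := by
    intro s' hs' ho τ'' hτ''
    have hT1 : 1 ≤ Tlo := by omega
    have h0 := hzeroΦ s' hs' ho τ'' (by omega)
    have h1 := hL9 τ'' (by omega) (s' : ℂ) (hSK7 s' hs')
    rwa [h0, sub_zero] at h1
  -- (4) derivatives of `f_{J,τ}` at the odd points
  set Fτ := S.F J₀ J boxJ p τ with hFτ
  have hε₉0 : 0 ≤ ε₉ := by
    show 0 ≤ Nr * Pr * (Q * GA * Real.exp (Ψ * (7 * (SK : ℝ)))) * (2 * x)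
    have : 0 ≤ Pr := by linarith
    have : 0 ≤ Q := by linarith
    have : 0 ≤ GA := by linarith
    have : 0 ≤ Nr := by linarith
    positivity
  have hderiv : ∀ s', s' < SK → Odd s' → ∀ σ, σ < t →
      ‖iteratedDeriv σ Fτ (s' : ℂ)‖ ≤ (1 + ∑ j, |S.l j|) ^ σ * ε₉ := by
    intro s' hs' ho σ hσ
    refine S.norm_iteratedDeriv_F_le_of_forall J₀ J boxJ p (s' : ℂ) (Tlo - 1)
      (fun τ'' hτ'' => hFsmall s' hs' ho τ'' hτ'') σ τ ?_
    omega
  -- (5) the function `g(z) = f_{J,τ}(2z+1)`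
  set g : ℂ → ℂ := fun z => Fτ (2 * z + 1) with hg
  have hFdiff : Differentiable ℂ Fτ := S.differentiable_F J₀ J boxJ p τ
  have hg_diff : Differentiable ℂ g := hFdiff.comp (by fun_prop)
  have hg_eq : g = fun z => (fun y => Fτ (2 * y)) (z + 1 / 2) := by
    funext z; simp only [hg]; congr 1; ring
  have hg_deriv : ∀ σ (z : ℂ), iteratedDeriv σ g z = 2 ^ σ * iteratedDeriv σ Fτ (2 * z + 1) := by
    intro σ z
    rw [hg_eq, iteratedDeriv_comp_add_const σ (fun y => Fτ (2 * y)) (1 / 2)]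
    simp only
    rw [iteratedDeriv_comp_const_mul (hFdiff.contDiff) (2 : ℂ)]
    simp only
    congr 2; ring
  have hCl1 : 1 ≤ Cl := le_trans (le_add_of_nonneg_right (sum_nonneg fun j _ => abs_nonneg _)) hCl
  have hl0 : 0 ≤ 1 + ∑ j, |S.l j| := by positivity
  set εH : ℝ := (2 * Cl) ^ t * ε₉ with hεH
  have hεH0 : 0 ≤ εH := by rw [hεH]; positivity
  have hg_small : ∀ i : ℕ, i < kpts → ∀ σ, σ < t → ‖iteratedDeriv σ g (i : ℂ)‖ ≤ εH := by
    intro i hi σ hσ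
    rw [hg_deriv, norm_mul, norm_pow, Complex.norm_ofNat]
    have hodd : Odd (2 * i + 1) := ⟨i, rfl⟩
    have hlt : 2 * i + 1 < SK := by omega
    have h1 := hderiv (2 * i + 1) hlt hodd σ hσ
    have hcast : (2 : ℂ) * (i : ℂ) + 1 = (((2 * i + 1 : ℕ)) : ℂ) := by push_cast; ring
    rw [hcast]
    calc (2 : ℝ) ^ σ * ‖iteratedDeriv σ Fτ (((2 * i + 1 : ℕ)) : ℂ)‖
        ≤ 2 ^ σ * ((1 + ∑ j, |S.l j|) ^ σ * ε₉) := mul_le_mul_of_nonneg_left h1 (by positivity)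
      _ = (2 * (1 + ∑ j, |S.l j|)) ^ σ * ε₉ := by rw [mul_pow]; ring
      _ ≤ (2 * Cl) ^ σ * ε₉ := by
          apply mul_le_mul_of_nonneg_right _ hε₉0
          exact pow_le_pow_left₀ (by positivity) (by linarith) σ
      _ ≤ (2 * Cl) ^ t * ε₉ := by
          apply mul_le_mul_of_nonneg_right _ hε₉0
          exact pow_le_pow_right₀ (by linarith) hσ.le
  -- the growth of `g` on `|z| = 6 kpts`
  have hg_bound : ∀ z ∈ Metric.sphere (0 : ℂ) (6 * kpts), ‖g z‖ ≤ Bf := by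
    intro z hz
    have hz' : ‖z‖ = 6 * kpts := by simpa using hz
    have h2z : ‖2 * z + 1‖ ≤ 7 * (SK : ℝ) := by
      calc ‖2 * z + 1‖ ≤ ‖2 * z‖ + ‖(1 : ℂ)‖ := norm_add_le _ _
        _ = 2 * (6 * kpts) + 1 := by rw [norm_mul, Complex.norm_ofNat, hz', norm_one]
        _ ≤ 7 * SK := by
            have : (2 * kpts : ℝ) ≤ SK := by exact_mod_cast hSK2
            have : (1 : ℝ) ≤ SK := by exact_mod_cast (by omega : 1 ≤ SK)
            linarith
    simp only [hg]
    have h1 := S.norm_F_le J₀ J boxJ p τ (2 * z + 1) (P := Pr) (Q := Q) (GA := GA) (Ψ := Ψ) hp_abs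
      (fun u hu => hQ u hu τ.1 (by unfold tauNorm at hτ; omega) _ h2z)
      (fun u hu => hA u hu τ.2 (by unfold tauNorm at hτ; omega))
      (fun u hu => (hψ u hu).2)
    calc ‖S.F J₀ J boxJ p τ (2 * z + 1)‖ ≤ (boxJ.card : ℝ) * Pr * (Q * GA * Real.exp (Ψ * ‖2 * z + 1‖)) := h1
      _ ≤ N * Pr * (Q * GA * Real.exp (Ψ * ‖2 * z + 1‖)) := hcardN (by positivity)
      _ ≤ Bf := by
          show N * Pr * (Q * GA * Real.exp (Ψ * ‖2 * z + 1‖)) ≤ Nr * Pr * (Q * GA * Real.exp (Ψ * (7 * (SK : ℝ))))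
          rw [← hN]
          apply mul_le_mul_of_nonneg_left _ (mul_nonneg hN0' (by linarith))
          apply mul_le_mul_of_nonneg_left _ (mul_nonneg (by linarith) (by linarith))
          exact Real.exp_le_exp.mpr (mul_le_mul_of_nonneg_left h2z hΨ0)
  -- (6) Hermite at `w₀ = (z₀ − 1)/2`
  set w₀ : ℂ := (z₀ - 1) / 2 with hw₀
  have hw₀2 : 2 * w₀ + 1 = z₀ := by rw [hw₀]; ring
  have hw₀n : ‖w₀‖ ≤ 2 * kpts := by rw [hw₀]; exact hz₀
  have hH := hermite_integer_points hg_diff hkpts1 ht1 hεH0 hg_small hg_bound hw₀n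
  have hFval : ‖Fτ z₀‖ ≤ 2 * (kpts : ℝ) ^ (t + 1) * t * (28 * Real.exp 1) ^ (kpts * t) * εH +
      Bf * (3 / 5) ^ (kpts * t) := by
    have : g w₀ = Fτ z₀ := by simp only [hg]; rw [hw₀2]
    rw [← this]; exact hH
  -- (7) Lemma 9 at `z₀`
  have h1 := hL9 τ (by omega) z₀ hz₀'
  have h2 : ‖S.Φ J₀ J boxJ p τ z₀‖ ≤ ‖Fτ z₀‖ + ‖Fτ z₀ - S.Φ J₀ J boxJ p τ z₀‖ := by
    have := norm_sub_le (Fτ z₀) (Fτ z₀ - S.Φ J₀ J boxJ p τ z₀)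
    rwa [sub_sub_cancel] at this
  rw [hεH] at hFval
  linarith

/-! ### Lemma 3.6: one step of the extrapolation in `k` -/

/-- **Waldschmidt 1980, Lemma 3.6 (one step `k → k+1` of the extrapolation).** Under the hypotheses
of `w80_norm_Φ_le_of_odd_zeros` (zeros at the odd `s' < SK`, `SK ≥ 2` even, for `|τ''| < Tlo`),
if moreover the denominators `D_J(s₁, τ)` of the integer points `s₁ < 2·SK` are `≤ Dmax` and
`δ < 1/Dmax`, then `φ_{J,τ}(s₁) = 0` for ALL odd `s₁ < 2·SK` and all `τ` with `|τ| + t ≤ Tlo`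
("finally, Lemma 3.4 and (3.16), (3.21) enable us to conclude that the considered numbers
`φ_{J,τ}(s)` vanish", p. 272). [cite: Waldschmidt1980, Lemma 3.6 (p. 272)] -/
theorem w80_kstep
    {J₀ J : ℕ} {L : Fin S.d → ℕ} {Lθ : ℕ} {p : Idx S.d h Lb → ℤ}
    {SK Tlo t : ℕ} (hSK : 2 ≤ SK) (hSKe : Even SK) (ht1 : 1 ≤ t)
    (hzero : ∀ s', s' < SK → Odd s' → ∀ τ'' : Tau S.d, tauNorm τ'' < Tlo →
      S.coreSum J₀ J (S.box (h := h) (Lb := Lb) L Lθ J) p τ'' s' = 0)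
    {Nr : ℝ} (hNr : ((S.box (h := h) (Lb := Lb) L Lθ J).card : ℝ) ≤ Nr) (hNr1 : 1 ≤ Nr)
    {Q GA Ψ x Cl Pr Dmax : ℝ} (hp_abs : ∀ u ∈ S.box (h := h) (Lb := Lb) L Lθ J, |(p u : ℝ)| ≤ Pr)
    (hPr : 1 ≤ Pr)
    (hQ : ∀ u ∈ S.box (h := h) (Lb := Lb) L Lθ J, ∀ m, m ≤ Tlo → ∀ z : ℂ, ‖z‖ ≤ 7 * (SK : ℝ) →
      ‖Qw m (S.wOf J₀ J u) 0 z‖ ≤ Q) (hQ1 : 1 ≤ Q)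
    (hA : ∀ u ∈ S.box (h := h) (Lb := Lb) L Lθ J, ∀ τ' : Fin S.d → ℕ, ∑ j, τ' j ≤ Tlo → ‖S.A u τ'‖ ≤ GA)
    (hGA1 : 1 ≤ GA)
    (hψ : ∀ u ∈ S.box (h := h) (Lb := Lb) L Lθ J, |S.ψ u| ≤ Ψ ∧ |S.expo u| ≤ Ψ) (hΨ0 : 0 ≤ Ψ)
    (hx : ((Lθ / 2 ^ J : ℕ) : ℝ) * |S.Λ₀| * (7 * (SK : ℝ)) ≤ x) (hx1 : x ≤ 1) (hx0 : 0 ≤ x)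
    (hCl : 1 + ∑ j, |S.l j| ≤ Cl)
    (hD : ∀ τ : Tau S.d, tauNorm τ + t ≤ Tlo → ∀ s₁, s₁ < 2 * SK →
      ((S.DclearJ (h := h) J₀ J L Lθ s₁ τ : ℕ) : ℝ) ≤ Dmax)
    (hfinal :
      let kpts : ℕ := SK / 2
      let ε₉ : ℝ := Nr * Pr * (Q * GA * Real.exp (Ψ * (7 * (SK : ℝ)))) * (2 * x)
      let Bf : ℝ := Nr * Pr * (Q * GA * Real.exp (Ψ * (7 * (SK : ℝ))))
      2 * (kpts : ℝ) ^ (t + 1) * t * (28 * Real.exp 1) ^ (kpts * t) * ((2 * Cl) ^ t * ε₉) +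
        Bf * (3 / 5) ^ (kpts * t) + ε₉ < 1 / Dmax) :
    ∀ s₁, s₁ < 2 * SK → Odd s₁ → ∀ τ : Tau S.d, tauNorm τ + t ≤ Tlo →
      S.coreSum J₀ J (S.box (h := h) (Lb := Lb) L Lθ J) p τ s₁ = 0 := by
  intro s₁ hs₁ hodd τ hτ
  -- the point `z₀ = s₁`
  have hz₀ : ‖(((s₁ : ℕ) : ℂ) - 1) / 2‖ ≤ 2 * ((SK / 2 : ℕ) : ℝ) := by
    obtain ⟨i, rfl⟩ := hodd
    have heven : 2 * (SK / 2) = SK := Nat.two_mul_div_two_of_even hSKe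
    have hcast : (((2 * i + 1 : ℕ) : ℂ) - 1) / 2 = ((i : ℕ) : ℂ) := by push_cast; ring
    rw [hcast, Complex.norm_natCast]
    have : i + 1 ≤ SK := by omega
    have : (i : ℝ) ≤ 2 * ((SK / 2 : ℕ) : ℝ) := by exact_mod_cast (by omega : i ≤ 2 * (SK / 2))
    exact this
  have hz₀' : ‖((s₁ : ℕ) : ℂ)‖ ≤ 7 * (SK : ℝ) := by
    rw [Complex.norm_natCast]
    have : (s₁ : ℝ) ≤ 2 * SK := by exact_mod_cast hs₁.le
    have : (0 : ℝ) ≤ SK := by positivity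
    linarith
  have hΦ := S.w80_norm_Φ_le_of_odd_zeros hSK ht1 hzero τ hτ hNr hNr1 hp_abs hPr hQ hQ1 hA hGA1 hψ hΨ0
    hx hx1 hx0 hCl ((s₁ : ℕ) : ℂ) hz₀ hz₀'
  refine S.coreSum_eq_zero_of_abs_lt J₀ J L Lθ p τ s₁ (hD τ hτ s₁ hs₁) ?_
  have hnorm : ‖S.Φ J₀ J (S.box (h := h) (Lb := Lb) L Lθ J) p τ ((s₁ : ℕ) : ℂ)‖ =
      |(S.coreSum J₀ J (S.box (h := h) (Lb := Lb) L Lθ J) p τ s₁ : ℝ)| := by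
    rw [S.Φ_natCast, ← Complex.ofReal_ratCast, Complex.norm_real, Real.norm_eq_abs]
  rw [← hnorm]
  exact lt_of_le_of_lt hΦ hfinal

/-! ### Lemma 3.7 and (3.22): the half points -/

set_option maxHeartbeats 800000 in
/-- **Waldschmidt 1980, Lemma 3.7 with the sharp Liouville estimate (3.22).** Under the
hypotheses of `w80_norm_Φ_le_of_odd_zeros` at level `J < J₀` with `2^J S₀ ≤ SK` (zeros at the odd
`s' < SK`, `|τ''| < Tlo`), the `2`-Kummer condition, bounds `Rmax ≥ |rHalf|` and `Dmax ≥ Dhalf`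
at the half points `s/2`, `s < 2^{J+1} S₀`, and the final inequality
`δ < M/(4 Dmax M (∏ H(αᵢ))²)^{2^{d+1}}`, `M = N Pr Rmax` (sharp Liouville,
`Waldschmidt1980.abs_ev_ge_sharp`, against the smallness `δ` of Lemma 3.5), we get
`φ_{J,τ}(s/2) = 0` for all odd `s < 2^{J+1} S₀` and `|τ| + t ≤ Tlo` ("Using Lemma 3.3 and (3.16),
(3.22) once more, we deduce Lemma 3.7", p. 272) — the hypothesis `half` of
`CW77.Setup.descent_algebra` as soon as `T/2^{J+1} + t ≤ Tlo`. [cite: Waldschmidt1980, Lemma 3.7 (p. 272)] -/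
theorem w80_halfstep
    (hind : ∀ T : Finset (Fin (S.d + 1)), T.Nonempty → ¬ IsSquare (∏ i ∈ T, S.all i))
    {J₀ J : ℕ} (hJ : J < J₀) {L : Fin S.d → ℕ} {Lθ S₀ : ℕ} {p : Idx S.d h Lb → ℤ}
    {SK Tlo t : ℕ} (hSK : 2 ≤ SK) (hSKS : 2 ^ J * S₀ ≤ SK) (ht1 : 1 ≤ t)
    (hzero : ∀ s', s' < SK → Odd s' → ∀ τ'' : Tau S.d, tauNorm τ'' < Tlo →
      S.coreSum J₀ J (S.box (h := h) (Lb := Lb) L Lθ J) p τ'' s' = 0)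
    {Nr : ℝ} (hNr : ((S.box (h := h) (Lb := Lb) L Lθ J).card : ℝ) ≤ Nr) (hNr1 : 1 ≤ Nr)
    {Q GA Ψ x Cl Pr Rmax Dmax : ℝ} (hp_abs : ∀ u ∈ S.box (h := h) (Lb := Lb) L Lθ J, |(p u : ℝ)| ≤ Pr)
    (hPr : 1 ≤ Pr)
    (hQ : ∀ u ∈ S.box (h := h) (Lb := Lb) L Lθ J, ∀ m, m ≤ Tlo → ∀ z : ℂ, ‖z‖ ≤ 7 * (SK : ℝ) →
      ‖Qw m (S.wOf J₀ J u) 0 z‖ ≤ Q) (hQ1 : 1 ≤ Q)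
    (hA : ∀ u ∈ S.box (h := h) (Lb := Lb) L Lθ J, ∀ τ' : Fin S.d → ℕ, ∑ j, τ' j ≤ Tlo → ‖S.A u τ'‖ ≤ GA)
    (hGA1 : 1 ≤ GA)
    (hψ : ∀ u ∈ S.box (h := h) (Lb := Lb) L Lθ J, |S.ψ u| ≤ Ψ ∧ |S.expo u| ≤ Ψ) (hΨ0 : 0 ≤ Ψ)
    (hx : ((Lθ / 2 ^ J : ℕ) : ℝ) * |S.Λ₀| * (7 * (SK : ℝ)) ≤ x) (hx1 : x ≤ 1) (hx0 : 0 ≤ x)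
    (hCl : 1 + ∑ j, |S.l j| ≤ Cl)
    (hR : ∀ u ∈ S.box (h := h) (Lb := Lb) L Lθ J, ∀ τ : Tau S.d, tauNorm τ + t ≤ Tlo →
      ∀ s, s < 2 ^ (J + 1) * S₀ → |(S.rHalf J₀ J u τ s : ℝ)| ≤ Rmax) (hR1 : 1 ≤ Rmax)
    (hD : ∀ τ : Tau S.d, tauNorm τ + t ≤ Tlo → ∀ s, s < 2 ^ (J + 1) * S₀ →
      ((S.Dhalf (h := h) J₀ J L Lθ s τ : ℕ) : ℝ) ≤ Dmax)
    (hfinal :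
      let kpts : ℕ := SK / 2
      let ε₉ : ℝ := Nr * Pr * (Q * GA * Real.exp (Ψ * (7 * (SK : ℝ)))) * (2 * x)
      let Bf : ℝ := Nr * Pr * (Q * GA * Real.exp (Ψ * (7 * (SK : ℝ))))
      2 * (kpts : ℝ) ^ (t + 1) * t * (28 * Real.exp 1) ^ (kpts * t) * ((2 * Cl) ^ t * ε₉) +
        Bf * (3 / 5) ^ (kpts * t) + ε₉ <
          (Nr * Pr * Rmax) / (4 * Dmax * (Nr * Pr * Rmax) * heightProd S.all ^ 2) ^ (2 ^ (S.d + 1))) :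
    ∀ s, s < 2 ^ (J + 1) * S₀ → Odd s → ∀ τ : Tau S.d, tauNorm τ + t ≤ Tlo →
      S.Φ J₀ J (S.box (h := h) (Lb := Lb) L Lθ J) p τ ((s : ℂ) / 2) = 0 := by
  classical
  intro s hs hodd τ hτ
  set boxJ := S.box (h := h) (Lb := Lb) L Lθ J with hboxJ
  -- the point `z₀ = s/2`
  have hsSK : s < 2 * SK := by
    have : 2 ^ (J + 1) * S₀ = 2 * (2 ^ J * S₀) := by ring
    omega
  have hz₀ : ‖((s : ℂ) / 2 - 1) / 2‖ ≤ 2 * ((SK / 2 : ℕ) : ℝ) := by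
    have h1 : ‖(s : ℂ) / 2 - 1‖ ≤ (s : ℝ) / 2 + 1 := by
      calc ‖(s : ℂ) / 2 - 1‖ ≤ ‖(s : ℂ) / 2‖ + ‖(1 : ℂ)‖ := norm_sub_le _ _
        _ = (s : ℝ) / 2 + 1 := by rw [norm_div, Complex.norm_natCast, Complex.norm_ofNat, norm_one]
    rw [norm_div, Complex.norm_ofNat, div_le_iff₀ (by norm_num : (0:ℝ) < 2)]
    have hs' : (s : ℝ) + 1 ≤ 2 * SK := by exact_mod_cast (by omega : s + 1 ≤ 2 * SK)
    have hk : (SK : ℝ) ≤ 2 * ((SK / 2 : ℕ) : ℝ) + 1 := by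
      exact_mod_cast (by omega : SK ≤ 2 * (SK / 2) + 1)
    have hk1 : (1 : ℝ) ≤ ((SK / 2 : ℕ) : ℝ) := by exact_mod_cast (show 1 ≤ SK / 2 by omega)
    linarith
  have hz₀' : ‖(s : ℂ) / 2‖ ≤ 7 * (SK : ℝ) := by
    rw [norm_div, Complex.norm_natCast, Complex.norm_ofNat, div_le_iff₀ (by norm_num : (0:ℝ) < 2)]
    have : (s : ℝ) ≤ 2 * SK := by exact_mod_cast hsSK.le
    have : (0 : ℝ) ≤ SK := by positivity
    linarith
  have hΦval := S.w80_norm_Φ_le_of_odd_zeros hSK ht1 hzero τ hτ hNr hNr1 hp_abs hPr hQ hQ1 hA hGA1 hψ hΨ0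
    hx hx1 hx0 hCl ((s : ℂ) / 2) hz₀ hz₀'
  set δ : ℝ := 2 * ((SK / 2 : ℕ) : ℝ) ^ (t + 1) * t * (28 * Real.exp 1) ^ ((SK / 2) * t) *
      ((2 * Cl) ^ t * (Nr * Pr * (Q * GA * Real.exp (Ψ * (7 * (SK : ℝ)))) * (2 * x))) +
      Nr * Pr * (Q * GA * Real.exp (Ψ * (7 * (SK : ℝ)))) * (3 / 5) ^ ((SK / 2) * t) +
      Nr * Pr * (Q * GA * Real.exp (Ψ * (7 * (SK : ℝ)))) * (2 * x) with hδ
  have hΦδ : ‖S.Φ J₀ J boxJ p τ ((s : ℂ) / 2)‖ ≤ δ := hΦval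
  -- Liouville
  by_cases hcv : S.classVec J₀ J boxJ p τ s = 0
  · rw [S.Φ_half hJ, hcv, ev_zero]; simp
  · exfalso
    set D : ℕ := S.Dhalf (h := h) J₀ J L Lθ s τ with hDdef
    have hD1 : 1 ≤ D := S.Dhalf_pos J₀ J L Lθ s τ
    set M : ℝ := Nr * Pr * Rmax with hM
    have hN0 : (0 : ℝ) ≤ Nr := by linarith
    have hM1 : 1 ≤ M := by
      rw [hM]
      have h1 : (1 : ℝ) ≤ Nr * Pr := by nlinarith
      nlinarith
    have hM0 : 0 < M := by linarith
    have hp_abs' : ∀ u ∈ boxJ, |(p u : ℝ)| ≤ Pr := hp_abs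
    have hcardN : (boxJ.card : ℝ) * Pr * Rmax ≤ M := by
      rw [hM]
      exact mul_le_mul_of_nonneg_right (mul_le_mul_of_nonneg_right hNr (by linarith)) (by linarith)
    have hcM : ∑ T', |(S.classVec J₀ J boxJ p τ s T' : ℝ)| ≤ M := by
      refine (S.sum_abs_classVec_le J₀ J boxJ p τ s).trans ?_
      calc ∑ u ∈ boxJ, |(p u : ℝ)| * |(S.rHalf J₀ J u τ s : ℝ)| ≤ ∑ _u ∈ boxJ, Pr * Rmax :=
            sum_le_sum fun u hu => mul_le_mul (hp_abs' u hu) (hR u hu τ hτ s hs) (abs_nonneg _) (by linarith)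
        _ = (boxJ.card : ℝ) * Pr * Rmax := by rw [sum_const, nsmul_eq_mul]; ring
        _ ≤ M := hcardN
    have hliou := Waldschmidt1980.abs_ev_ge_sharp (S.d + 1) S.all S.all_pos hind _ hcv D hD1
      (S.exists_int_Dhalf_mul_classVec J₀ J L Lθ τ s) M hM1 hcM
    -- the smallness of `|ev|`
    have hev_le : |ev S.all (S.classVec J₀ J boxJ p τ s)| ≤ δ := by
      have hfac := S.Φ_half hJ boxJ p τ s
      have hnorm : ‖S.Φ J₀ J boxJ p τ ((s : ℂ) / 2)‖ =
          2 ^ τ.1 * |ev S.all (S.classVec J₀ J boxJ p τ s)| := by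
        rw [hfac, norm_mul, norm_pow, Complex.norm_ofNat, Complex.norm_real, Real.norm_eq_abs]
      have h2 : (1 : ℝ) ≤ 2 ^ τ.1 := one_le_pow₀ (by norm_num)
      calc |ev S.all (S.classVec J₀ J boxJ p τ s)|
          = 1 * |ev S.all (S.classVec J₀ J boxJ p τ s)| := (one_mul _).symm
        _ ≤ 2 ^ τ.1 * |ev S.all (S.classVec J₀ J boxJ p τ s)| :=
            mul_le_mul_of_nonneg_right h2 (abs_nonneg _)
        _ = ‖S.Φ J₀ J boxJ p τ ((s : ℂ) / 2)‖ := hnorm.symm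
        _ ≤ δ := hΦδ
    -- comparing with `hfinal`: the Liouville bound is monotone in `D ≤ Dmax`
    have hDle : (D : ℝ) ≤ Dmax := hD τ hτ s hs
    have hPht : 1 ≤ heightProd S.all := one_le_heightProd _
    have hD0 : (0 : ℝ) < D := by exact_mod_cast hD1
    have hbase : 0 < 4 * (D : ℝ) * M * heightProd S.all ^ 2 := by positivity
    have hmono : M / (4 * Dmax * M * heightProd S.all ^ 2) ^ (2 ^ (S.d + 1)) ≤
        M / (4 * (D : ℝ) * M * heightProd S.all ^ 2) ^ (2 ^ (S.d + 1)) := by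
      apply div_le_div_of_nonneg_left hM0.le (pow_pos hbase _)
      apply pow_le_pow_left₀ hbase.le
      have : 0 ≤ M * heightProd S.all ^ 2 := by positivity
      nlinarith
    have hfin : δ < M / (4 * Dmax * M * heightProd S.all ^ 2) ^ (2 ^ (S.d + 1)) := by
      rw [hM, hδ]; exact hfinal
    linarith [hliou, hev_le, hmono, hfin]

end Setup

end Literature.NumberTheory.Transcendental.CW77

end
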